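import Literature.Analysis.SpecialFunctions.GammaStirlingUniform
import Mathlib.Analysis.SpecialFunctions.Gamma.Beta
import Mathlib.Analysis.SpecialFunctions.Gamma.Deriv
import HarnessLib

/-!
# Inverse-factorial asymptotics of the Gauss ratio `Γ(v)Γ(v−a−b)/(Γ(v−a)Γ(v−b))`

Topic `Literature/Analysis/SpecialFunctions` (companion of `GammaStirlingUniform.lean`,
`GammaRatioStirling.lean`, `GammaVerticalRatio.lean`). Everything here is PROVED; there are no
named facts.

For complex parameters `a, b` put

  `G(v) = Γ(v) Γ(v − a − b) / (Γ(v − a) Γ(v − b))`,  `q_k = (a)_k (b)_k / k!`,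
  `φ_k(v) = 1/(v(v+1)⋯(v+k−1)) = Γ(v)/Γ(v+k)`.

Gauss's summation theorem says `₂F₁(a, b; v; 1) = G(v)` for `Re v > Re(a+b)`, i.e. `G(v) = Σ_k q_k φ_k(v)`
is a convergent *inverse factorial series* (Whittaker–Watson §14·11; Nörlund, Kap. 8). Mathlib has
no hypergeometric functions and no complex Stirling series; this file proves the ASYMPTOTIC form of
Gauss's theorem, to every order and uniformly up to the imaginary axis:

* `Literature.Analysis.SpecialFunctions.GaussRatio.norm_gaussRatio_sub_partialSum_le` — for every `K` there are
  `R, C` with `‖G(v) − Σ_{k ≤ K} q_k φ_k(v)‖ ≤ C/‖v‖^{K+1}` for all `v` with `0 < Re v`, `R ≤ ‖v‖`.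

Since `φ_k(v) = v^{−k}(1 + O(1/v))`, this is equivalent to all orders to the Stirling-type expansion
`G(v) = 1 + c₁/v + ⋯ + c_K/v^K + O(|v|^{−K−1})` of a balanced ratio of four Gamma functions
(Tricomi–Erdélyi); the special case `a = 1/4`, `b = −1/4`, where by the duplication formula
`2^s Γ(s/2)² = √(8π) Γ(s − 1/2) G(s/2)` (`Literature.Analysis.SpecialFunctions.GaussRatio.two_cpow_mul_Gamma_half_sq`),
is formula (13) of [Booker2003] (`Γ(s/2)²/(2^{-s}Γ(s−1/2)) = √(8π)(1 + c₁/s + ⋯ + O(s^{-n-1}))`,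
`Re s ≥ 1`), the input of his Lemma 3.

## Proof (difference equation + multiplicative telescoping; no integrals, no Stirling series)

This is Gauss's own argument for §14·11 as presented by Whittaker–Watson (iterate the contiguity
relation `F(a,b;c;1) = [(c−a)(c−b)/(c(c−a−b))] F(a,b;c+1;1)` and let `c → c + m → ∞`, using
Euler's product §12·13 and `F(a,b;c+m;1) → 1`), run for the TRUNCATED series with the error kept
explicit. `G(v+1) = Ψ(v) G(v)` with `Ψ(v) = v(v−a−b)/((v−a)(v−b))` (`gaussRatio_add_one`). The truncation
`T_K = Σ_{k≤K} q_k φ_k` satisfies the SAME recursion up to one explicit top term,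
`(v−a)(v−b) T_K(v+1) − v(v−a−b) T_K(v) = v (K+a)(K+b) q_K φ_{K+1}(v)` (`defect_partialSum`, from
`φ_k(v+1) = v φ_{k+1}(v)`, `φ_k(v) = (v+k) φ_{k+1}(v)` and the two-term recursion of `q_k`), whence
`Q = G/T_K` obeys `Q(v) = Q(v+1)(1 + η(v))` with `‖η(v)‖ ≤ 4M/‖v‖^{K+2}` (`M = ‖(K+a)(K+b)q_K‖`).
Iterating, `Q(v) = Q(v+N) ∏_{j<N} (1 + η(v+j))`; Euler's limit formula (Mathlib
`Complex.GammaSeq_tendsto_Gamma`) gives `G(v+N) → 1`, hence `Q(v+N) → 1`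
(`tendsto_gaussRatio_add_nat`), and `Σ_j ‖v+j‖^{−2} ≤ 1/‖v‖² + π/(2‖v‖)`
(`GammaStirling.sum_inv_norm_add_sq_le`) bounds the product: `‖Q(v) − 1‖ ≤ 24M/‖v‖^{K+1}`.

## References

* C. F. Gauss, *Disquisitiones generales circa seriem infinitam* (1813), §23 (the summation theorem).
* E. T. Whittaker, G. N. Watson, *A Course of Modern Analysis*, 4th ed. (1927), §14·11, §12·15.
* N. E. Nörlund, *Vorlesungen über Differenzenrechnung* (1924), Kap. 8 (Fakultätenreihen).
* F. G. Tricomi, A. Erdélyi, *The asymptotic expansion of a ratio of gamma functions*,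
  Pacific J. Math. 1 (1951), 133–142.
* [Booker2003] A. R. Booker, *Poles of Artin L-functions and the strong Artin conjecture*,
  Ann. of Math. 158 (2003), 1089–1098, (13) p. 1094.
-/

noncomputable section

open Complex Filter Topology Finset

open scoped Nat

namespace Literature.Analysis.SpecialFunctions

namespace GaussRatio

/-! ### The objects -/

/-- The Gauss coefficients `q_k = (a)_k (b)_k / k!`, through `q_0 = 1`,
`q_{k+1} = q_k (k+a)(k+b)/(k+1)`. [folklore] -/
def coeff (a b : ℂ) : ℕ → ℂ
  | 0 => 1
  | k + 1 => coeff a b k * ((k + a) * (k + b) / (k + 1))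

/-- The inverse rising factorial `φ_k(v) = 1/(v(v+1)⋯(v+k−1))` (`= Γ(v)/Γ(v+k)`). [folklore] -/
def invRising (v : ℂ) (k : ℕ) : ℂ := (∏ i ∈ Finset.range k, (v + i))⁻¹

/-- The Gauss ratio `G(v) = Γ(v)Γ(v−a−b)/(Γ(v−a)Γ(v−b))` (the value `₂F₁(a,b;v;1)`), written with
Mathlib's entire `1/Γ`. [folklore] -/
def gaussRatio (a b v : ℂ) : ℂ :=
  Gamma v * Gamma (v - a - b) * ((Gamma (v - a))⁻¹ * (Gamma (v - b))⁻¹)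

/-- The truncated inverse factorial series `T_K(v) = Σ_{k ≤ K} q_k φ_k(v)`. [folklore] -/
def partialSum (a b : ℂ) (K : ℕ) (v : ℂ) : ℂ :=
  ∑ k ∈ Finset.range (K + 1), coeff a b k * invRising v k

/-- The top term `ε_K(v) = (K+a)(K+b) q_K φ_{K+1}(v)/(v−a−b)` of the defect of `T_K`. [folklore] -/
def eps (a b : ℂ) (K : ℕ) (v : ℂ) : ℂ :=
  (K + a) * (K + b) * coeff a b K * invRising v (K + 1) / (v - a - b)

/-- `q_0 = 1`. [folklore] -/
@[simp] lemma coeff_zero (a b : ℂ) : coeff a b 0 = 1 := rfl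

/-- `q_{k+1} = q_k (k+a)(k+b)/(k+1)`. [folklore] -/
lemma coeff_succ (a b : ℂ) (k : ℕ) :
    coeff a b (k + 1) = coeff a b k * ((k + a) * (k + b) / (k + 1)) := rfl

/-- The two-term recursion in polynomial form: `(k+1) q_{k+1} = (k+a)(k+b) q_k`. [folklore] -/
lemma coeff_succ_mul (a b : ℂ) (k : ℕ) :
    coeff a b (k + 1) * (k + 1) = coeff a b k * ((k + a) * (k + b)) := by
  rw [coeff_succ]
  have hk : (k : ℂ) + 1 ≠ 0 := by exact_mod_cast Nat.succ_ne_zero k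
  field_simp

/-- `φ_0 = 1`. [folklore] -/
@[simp] lemma invRising_zero (v : ℂ) : invRising v 0 = 1 := by simp [invRising]

/-- `φ_1(v) = 1/v`. [folklore] -/
lemma invRising_one (v : ℂ) : invRising v 1 = v⁻¹ := by simp [invRising]

/-- `T_0 = 1`. [folklore] -/
@[simp] lemma partialSum_zero (a b v : ℂ) : partialSum a b 0 v = 1 := by simp [partialSum]

/-- `T_{K+1} = T_K + q_{K+1} φ_{K+1}`. [folklore] -/
lemma partialSum_succ (a b : ℂ) (K : ℕ) (v : ℂ) :
    partialSum a b (K + 1) v = partialSum a b K v + coeff a b (K + 1) * invRising v (K + 1) := by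
  rw [partialSum, partialSum, Finset.sum_range_succ]

/-- `φ_k(v) = (v+k) φ_{k+1}(v)` (`v + k ≠ 0`). [folklore] -/
lemma invRising_eq_mul_succ {v : ℂ} {k : ℕ} (hvk : v + k ≠ 0) :
    invRising v k = (v + k) * invRising v (k + 1) := by
  unfold invRising
  rw [Finset.prod_range_succ, mul_inv, ← mul_assoc, mul_comm (v + k), mul_assoc,
    mul_inv_cancel₀ hvk, mul_one]

/-- `φ_k(v+1) = v φ_{k+1}(v)` (`v ≠ 0`). [folklore] -/
lemma invRising_add_one {v : ℂ} (hv : v ≠ 0) (k : ℕ) :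
    invRising (v + 1) k = v * invRising v (k + 1) := by
  unfold invRising
  rw [Finset.prod_range_succ']
  simp only [Nat.cast_add, Nat.cast_one, Nat.cast_zero, add_zero]
  have : ∏ i ∈ Finset.range k, (v + 1 + (i : ℂ)) = ∏ i ∈ Finset.range k, (v + ((i : ℂ) + 1)) :=
    Finset.prod_congr rfl fun i _ => by ring
  rw [this, mul_inv, mul_comm _ v⁻¹, ← mul_assoc, mul_inv_cancel₀ hv, one_mul]

/-- `‖v‖ ≤ ‖v + i‖` for `Re v ≥ 0`, `i ∈ ℕ`. [folklore] -/
lemma norm_le_norm_add_nat {v : ℂ} (hv : 0 ≤ v.re) (i : ℕ) : ‖v‖ ≤ ‖v + i‖ := by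
  have h1 : ‖v‖ ^ 2 ≤ ‖v + (i : ℂ)‖ ^ 2 := by
    rw [Complex.sq_norm, Complex.sq_norm, Complex.normSq_apply, Complex.normSq_apply]
    simp only [add_re, natCast_re, add_im, natCast_im, add_zero]
    nlinarith [(i.cast_nonneg : (0 : ℝ) ≤ i)]
  exact le_of_pow_le_pow_left₀ two_ne_zero (norm_nonneg _) h1

/-- `v + i ≠ 0` for `Re v > 0`, `i ∈ ℕ`. [folklore] -/
lemma add_nat_ne_zero {v : ℂ} (hv : 0 < v.re) (i : ℕ) : v + i ≠ 0 := by
  intro h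
  have := congrArg Complex.re h
  simp at this
  linarith [(i.cast_nonneg : (0 : ℝ) ≤ i)]

/-- `v + j ≠ -m` for `Re v > 0`, `j, m ∈ ℕ` (the shifted points avoid the poles of `Γ`).
[folklore] -/
lemma add_nat_ne_neg_nat {v : ℂ} (hv : 0 < v.re) (j m : ℕ) : v + j ≠ -m := by
  intro h
  have := congrArg Complex.re h
  simp at this
  linarith [(m.cast_nonneg : (0 : ℝ) ≤ m), (j.cast_nonneg : (0 : ℝ) ≤ j)]

/-- `‖φ_k(v)‖ ≤ ‖v‖^{-k}` for `Re v ≥ 0` (each factor has `‖v + i‖ ≥ ‖v‖`). [folklore] -/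
lemma norm_invRising_le {v : ℂ} (hv : 0 ≤ v.re) (k : ℕ) :
    ‖invRising v k‖ ≤ (‖v‖ ^ k)⁻¹ := by
  unfold invRising
  rw [norm_inv, norm_prod]
  rcases eq_or_ne v 0 with rfl | hv0
  · rcases Nat.eq_zero_or_pos k with rfl | hk
    · simp
    · rw [Finset.prod_eq_zero (Finset.mem_range.mpr hk) (by simp), inv_zero, norm_zero,
        zero_pow hk.ne', inv_zero]
  have hvpos : 0 < ‖v‖ := norm_pos_iff.mpr hv0
  apply inv_anti₀ (pow_pos hvpos k)
  calc ‖v‖ ^ k = ∏ _i ∈ Finset.range k, ‖v‖ := by simp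
    _ ≤ ∏ i ∈ Finset.range k, ‖v + (i : ℂ)‖ :=
        Finset.prod_le_prod (fun i _ => hvpos.le) fun i _ => norm_le_norm_add_nat hv i

/-! ### The difference equation and the defect of the truncation -/

/-- One term: `(v−a)(v−b) φ_k(v+1) − v(v−a−b) φ_k(v) = v(−k φ_k(v) + (k+a)(k+b) φ_{k+1}(v))`.
[folklore] -/
lemma term_identity (a b : ℂ) {v : ℂ} (hv : v ≠ 0) {k : ℕ} (hvk : v + k ≠ 0) :
    (v - a) * (v - b) * invRising (v + 1) k - v * (v - a - b) * invRising v k =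
      v * (-(k : ℂ) * invRising v k + (k + a) * (k + b) * invRising v (k + 1)) := by
  rw [invRising_add_one hv, invRising_eq_mul_succ hvk]
  ring

/-- The defect identity of the truncation under `v ↦ v+1`:
`(v−a)(v−b) T_K(v+1) − v(v−a−b) T_K(v) = v (K+a)(K+b) q_K φ_{K+1}(v)`. [folklore] -/
theorem defect_partialSum (a b : ℂ) {v : ℂ} (hv : ∀ i : ℕ, v + i ≠ 0) (K : ℕ) :
    (v - a) * (v - b) * partialSum a b K (v + 1) - v * (v - a - b) * partialSum a b K v =
      v * ((K + a) * (K + b) * coeff a b K * invRising v (K + 1)) := by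
  have hv0 : v ≠ 0 := by simpa using hv 0
  induction K with
  | zero =>
    simp only [partialSum_zero, coeff_zero, Nat.cast_zero, zero_add, invRising_one]
    field_simp
    ring
  | succ K ih =>
    rw [partialSum_succ, partialSum_succ]
    have h2 := term_identity a b hv0 (hv (K + 1))
    have h3 := coeff_succ_mul a b K
    push_cast at h2 ⊢
    linear_combination ih + coeff a b (K + 1) * h2 - v * invRising v (K + 1) * h3

/-- The first-order difference equation of the Gauss ratio:
`(v−a)(v−b) G(v+1) = v(v−a−b) G(v)`. [folklore] -/
theorem gaussRatio_add_one (a b : ℂ) {v : ℂ} (h0 : v ≠ 0) (h1 : v - a - b ≠ 0) (h2 : v - a ≠ 0)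
    (h3 : v - b ≠ 0) :
    (v - a) * (v - b) * gaussRatio a b (v + 1) = v * (v - a - b) * gaussRatio a b v := by
  unfold gaussRatio
  have e1 : v + 1 - a - b = (v - a - b) + 1 := by ring
  have e2 : v + 1 - a = (v - a) + 1 := by ring
  have e3 : v + 1 - b = (v - b) + 1 := by ring
  rw [e1, e2, e3, Gamma_add_one _ h0, Gamma_add_one _ h1, Gamma_add_one _ h2, Gamma_add_one _ h3,
    mul_inv, mul_inv]
  have hX : (v - a) * (v - a)⁻¹ = 1 := mul_inv_cancel₀ h2
  have hY : (v - b) * (v - b)⁻¹ = 1 := mul_inv_cancel₀ h3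
  linear_combination v * (v - a - b) * Gamma v * Gamma (v - a - b) * (Gamma (v - a))⁻¹ *
    (Gamma (v - b))⁻¹ * ((v - b) * (v - b)⁻¹ * hX + hY)

/-- Cross-multiplied one-step relation between `G` and its truncation:
`G(v) T_K(v+1) = G(v+1) (T_K(v) + ε_K(v))`. [folklore] -/
theorem gaussRatio_mul_partialSum_add_one (a b : ℂ) {v : ℂ} (hv : ∀ i : ℕ, v + i ≠ 0)
    (h1 : v - a - b ≠ 0) (h2 : v - a ≠ 0) (h3 : v - b ≠ 0) (K : ℕ) :
    gaussRatio a b v * partialSum a b K (v + 1) =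
      gaussRatio a b (v + 1) * (partialSum a b K v + eps a b K v) := by
  have hv0 : v ≠ 0 := by simpa using hv 0
  have hD := defect_partialSum a b hv K
  have hG := gaussRatio_add_one a b hv0 h1 h2 h3
  have hab : (v - a) * (v - b) ≠ 0 := mul_ne_zero h2 h3
  have hE : v * ((K + a) * (K + b) * coeff a b K * invRising v (K + 1)) =
      v * (v - a - b) * eps a b K v := by
    unfold eps
    field_simp
  apply mul_left_cancel₀ hab
  linear_combination gaussRatio a b v * hD + gaussRatio a b v * hE -
    (partialSum a b K v + eps a b K v) * hG

/-- The multiplicative one-step relation for `Q = G/T_K`: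
`Q(v) = Q(v+1) (1 + ε_K(v)/T_K(v))`. [folklore] -/
theorem quot_eq_quot_add_one_mul (a b : ℂ) {v : ℂ} (hv : ∀ i : ℕ, v + i ≠ 0)
    (h1 : v - a - b ≠ 0) (h2 : v - a ≠ 0) (h3 : v - b ≠ 0) (K : ℕ)
    (hT : partialSum a b K v ≠ 0) (hT1 : partialSum a b K (v + 1) ≠ 0) :
    gaussRatio a b v / partialSum a b K v =
      gaussRatio a b (v + 1) / partialSum a b K (v + 1) *
        (1 + eps a b K v / partialSum a b K v) := by
  have h := gaussRatio_mul_partialSum_add_one a b hv h1 h2 h3 K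
  rw [one_add_div hT, div_mul_div_comm, ← h, mul_comm (partialSum a b K (v + 1)) (partialSum a b K v),
    mul_div_mul_right _ _ hT1]

/-! ### Size of the truncation and of the defect -/

/-- `Σ_{1 ≤ k ≤ K} ‖q_k‖`. [folklore] -/
def coeffNormSum (a b : ℂ) (K : ℕ) : ℝ := ∑ k ∈ Finset.range K, ‖coeff a b (k + 1)‖

/-- `Σ_{1 ≤ k ≤ K} ‖q_k‖ ≥ 0`. [folklore] -/
lemma coeffNormSum_nonneg (a b : ℂ) (K : ℕ) : 0 ≤ coeffNormSum a b K :=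
  Finset.sum_nonneg fun _ _ => norm_nonneg _

/-- `‖T_K(v) − 1‖ ≤ (Σ_{1≤k≤K} ‖q_k‖)/‖v‖` for `Re v ≥ 0`, `‖v‖ ≥ 1`. [folklore] -/
lemma norm_partialSum_sub_one_le (a b : ℂ) (K : ℕ) {v : ℂ} (hv : 0 ≤ v.re) (h1 : 1 ≤ ‖v‖) :
    ‖partialSum a b K v - 1‖ ≤ coeffNormSum a b K / ‖v‖ := by
  have hv0 : 0 < ‖v‖ := by linarith
  have hsplit : partialSum a b K v - 1 =
      ∑ k ∈ Finset.range K, coeff a b (k + 1) * invRising v (k + 1) := by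
    rw [partialSum, Finset.sum_range_succ']
    simp
  rw [hsplit, coeffNormSum, Finset.sum_div]
  refine (norm_sum_le _ _).trans (Finset.sum_le_sum fun k _ => ?_)
  rw [norm_mul, div_eq_mul_inv]
  refine mul_le_mul_of_nonneg_left ?_ (norm_nonneg _)
  refine (norm_invRising_le hv (k + 1)).trans ?_
  exact inv_anti₀ hv0 (by simpa using pow_le_pow_right₀ h1 (Nat.succ_le_succ (Nat.zero_le k)))

/-- `‖ε_K(v)‖ ≤ 2M/‖v‖^{K+2}` with `M = ‖(K+a)(K+b) q_K‖`, once `‖v‖ ≥ 2‖a‖ + 2‖b‖`, `Re v ≥ 0`,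
`v ≠ 0`. [folklore] -/
lemma norm_eps_le (a b : ℂ) (K : ℕ) {v : ℂ} (hv : 0 ≤ v.re) (hv0 : 0 < ‖v‖)
    (hR : 2 * ‖a‖ + 2 * ‖b‖ ≤ ‖v‖) :
    ‖eps a b K v‖ ≤ 2 * ‖(K + a) * (K + b) * coeff a b K‖ / ‖v‖ ^ (K + 2) := by
  have hden : ‖v‖ / 2 ≤ ‖v - a - b‖ := by
    have : ‖v‖ ≤ ‖v - a - b‖ + ‖a + b‖ := by
      calc ‖v‖ = ‖(v - a - b) + (a + b)‖ := by ring_nf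
        _ ≤ ‖v - a - b‖ + ‖a + b‖ := norm_add_le _ _
    have hab : ‖a + b‖ ≤ ‖a‖ + ‖b‖ := norm_add_le a b
    linarith
  have hden0 : 0 < ‖v - a - b‖ := by linarith
  unfold eps
  rw [norm_div, norm_mul, div_le_div_iff₀ hden0 (by positivity)]
  have hφ := norm_invRising_le hv (K + 1)
  have hM := norm_nonneg ((K + a) * (K + b) * coeff a b K)
  calc ‖(K + a) * (K + b) * coeff a b K‖ * ‖invRising v (K + 1)‖ * ‖v‖ ^ (K + 2)
      ≤ ‖(K + a) * (K + b) * coeff a b K‖ * (‖v‖ ^ (K + 1))⁻¹ * ‖v‖ ^ (K + 2) := by gcongr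
    _ = ‖(K + a) * (K + b) * coeff a b K‖ * ‖v‖ := by
        field_simp
        ring
    _ ≤ 2 * ‖(K + a) * (K + b) * coeff a b K‖ * ‖v - a - b‖ := by nlinarith

/-- `‖∏_{j<N} (1 + η_j) − 1‖ ≤ exp(Σ_{j<N} ‖η_j‖) − 1`. [folklore] -/
lemma norm_prod_one_add_sub_one_le (η : ℕ → ℂ) (N : ℕ) :
    ‖∏ j ∈ Finset.range N, (1 + η j) - 1‖ ≤ Real.exp (∑ j ∈ Finset.range N, ‖η j‖) - 1 := by
  induction N with
  | zero => simp
  | succ N ih =>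
    rw [Finset.prod_range_succ, Finset.sum_range_succ, Real.exp_add]
    have hsplit : (∏ j ∈ Finset.range N, (1 + η j)) * (1 + η N) - 1 =
        ((∏ j ∈ Finset.range N, (1 + η j)) - 1) * (1 + η N) + η N := by ring
    rw [hsplit]
    have hS : 0 ≤ ∑ j ∈ Finset.range N, ‖η j‖ := Finset.sum_nonneg fun _ _ => norm_nonneg _
    have hE1 : 1 ≤ Real.exp (∑ j ∈ Finset.range N, ‖η j‖) := Real.one_le_exp hS
    have hE2 : 1 + ‖η N‖ ≤ Real.exp ‖η N‖ := by
      have := Real.add_one_le_exp ‖η N‖; linarith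
    have hE3 : ‖1 + η N‖ ≤ 1 + ‖η N‖ := (norm_add_le _ _).trans (by simp)
    have hE4 := mul_le_mul_of_nonneg_left hE2 (Real.exp_pos (∑ j ∈ Finset.range N, ‖η j‖)).le
    calc ‖((∏ j ∈ Finset.range N, (1 + η j)) - 1) * (1 + η N) + η N‖
        ≤ ‖(∏ j ∈ Finset.range N, (1 + η j)) - 1‖ * ‖1 + η N‖ + ‖η N‖ := by
          refine (norm_add_le _ _).trans ?_
          rw [norm_mul]
      _ ≤ (Real.exp (∑ j ∈ Finset.range N, ‖η j‖) - 1) * (1 + ‖η N‖) + ‖η N‖ := by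
          have := mul_le_mul ih hE3 (norm_nonneg _) (by linarith)
          linarith
      _ = Real.exp (∑ j ∈ Finset.range N, ‖η j‖) * (1 + ‖η N‖) - 1 := by ring
      _ ≤ Real.exp (∑ j ∈ Finset.range N, ‖η j‖) * Real.exp ‖η N‖ - 1 := by linarith

/-! ### Euler's limit formula: `G(v + N) → 1` -/

/-- `Γ(s + (n+1)) = Γ(s) ∏_{j ≤ n} (s + j)` off the poles of `Γ`. [folklore] -/
lemma Gamma_add_nat_succ {s : ℂ} (hs : ∀ m : ℕ, s ≠ -m) (n : ℕ) :
    Gamma (s + (n + 1)) = Gamma s * ∏ j ∈ Finset.range (n + 1), (s + j) := by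
  induction n with
  | zero =>
    have h0 : s ≠ 0 := by simpa using hs 0
    simp only [Nat.cast_zero, zero_add, Finset.prod_range_one, add_zero]
    rw [Gamma_add_one _ h0, mul_comm]
  | succ n ih =>
    rw [Finset.prod_range_succ, ← mul_assoc, ← ih]
    have hne : s + (n + 1) ≠ 0 := by
      intro h
      apply hs (n + 1)
      push_cast
      linear_combination h
    have : s + ((n + 1 : ℕ) + 1) = (s + (n + 1)) + 1 := by push_cast; ring
    rw [this, Gamma_add_one _ hne]
    push_cast
    ring

/-- `Γ(s + (n+1)) · GammaSeq s n = n^s n! Γ(s)` off the poles. [folklore] -/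
lemma Gamma_add_nat_succ_mul_GammaSeq {s : ℂ} (hs : ∀ m : ℕ, s ≠ -m) (n : ℕ) :
    Gamma (s + (n + 1)) * GammaSeq s n = (n : ℂ) ^ s * n ! * Gamma s := by
  have hP : ∏ j ∈ Finset.range (n + 1), (s + (j : ℂ)) ≠ 0 := by
    rw [Finset.prod_ne_zero_iff]
    intro j _ h
    apply hs j
    linear_combination h
  rw [Gamma_add_nat_succ hs n, GammaSeq, mul_assoc, mul_div_cancel₀ _ hP]
  ring

/-- `GammaSeq s n ≠ 0` for `n ≠ 0` off the poles. [folklore] -/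
lemma GammaSeq_ne_zero' {s : ℂ} (hs : ∀ m : ℕ, s ≠ -m) {n : ℕ} (hn : n ≠ 0) :
    GammaSeq s n ≠ 0 := by
  have hP : ∏ j ∈ Finset.range (n + 1), (s + (j : ℂ)) ≠ 0 := by
    rw [Finset.prod_ne_zero_iff]
    intro j _ h
    apply hs j
    linear_combination h
  unfold GammaSeq
  refine div_ne_zero (mul_ne_zero ?_ (by exact_mod_cast Nat.factorial_ne_zero n)) hP
  rw [Ne, cpow_eq_zero_iff, not_and_or]
  exact Or.inl (by exact_mod_cast hn)

/-- Euler's limit formula for the balanced ratio: `G(v + N) → 1` as `N → ∞`, whenever none of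
`v, v−a−b, v−a, v−b` is a pole of `Γ`. [folklore] -/
theorem tendsto_gaussRatio_add_nat (a b : ℂ) {v : ℂ} (hv : ∀ m : ℕ, v ≠ -m)
    (h1 : ∀ m : ℕ, v - a - b ≠ -m) (h2 : ∀ m : ℕ, v - a ≠ -m) (h3 : ∀ m : ℕ, v - b ≠ -m) :
    Tendsto (fun N : ℕ => gaussRatio a b (v + N)) atTop (𝓝 1) := by
  have hΓ0 := Gamma_ne_zero hv
  have hΓ1 := Gamma_ne_zero h1
  have hΓ2 := Gamma_ne_zero h2
  have hΓ3 := Gamma_ne_zero h3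
  -- the limit of the `GammaSeq` expression
  have hlim : Tendsto (fun n : ℕ => gaussRatio a b v *
      (GammaSeq (v - a) n * GammaSeq (v - b) n / (GammaSeq v n * GammaSeq (v - a - b) n)))
      atTop (𝓝 1) := by
    have h : Tendsto (fun n : ℕ => GammaSeq (v - a) n * GammaSeq (v - b) n /
        (GammaSeq v n * GammaSeq (v - a - b) n)) atTop
        (𝓝 (Gamma (v - a) * Gamma (v - b) / (Gamma v * Gamma (v - a - b)))) :=
      ((GammaSeq_tendsto_Gamma (v - a)).mul (GammaSeq_tendsto_Gamma (v - b))).div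
        ((GammaSeq_tendsto_Gamma v).mul (GammaSeq_tendsto_Gamma (v - a - b)))
        (mul_ne_zero hΓ0 hΓ1)
    have hval : gaussRatio a b v * (Gamma (v - a) * Gamma (v - b) / (Gamma v * Gamma (v - a - b))) = 1 := by
      unfold gaussRatio
      field_simp
    have h' := h.const_mul (gaussRatio a b v)
    rwa [hval] at h'
  -- eventual equality with `G(v + (n+1))`
  have hev : ∀ n : ℕ, n ≠ 0 → gaussRatio a b (v + (n + 1)) = gaussRatio a b v *
      (GammaSeq (v - a) n * GammaSeq (v - b) n / (GammaSeq v n * GammaSeq (v - a - b) n)) := by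
    intro n hn
    have hn' : (n : ℂ) ≠ 0 := by exact_mod_cast hn
    have k0 := Gamma_add_nat_succ_mul_GammaSeq hv n
    have k1 := Gamma_add_nat_succ_mul_GammaSeq h1 n
    have k2 := Gamma_add_nat_succ_mul_GammaSeq h2 n
    have k3 := Gamma_add_nat_succ_mul_GammaSeq h3 n
    have g0 := GammaSeq_ne_zero' hv hn
    have g1 := GammaSeq_ne_zero' h1 hn
    have g2 := GammaSeq_ne_zero' h2 hn
    have g3 := GammaSeq_ne_zero' h3 hn
    have hfact : ((n ! : ℕ) : ℂ) ≠ 0 := by exact_mod_cast Nat.factorial_ne_zero n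
    have c2 : (n : ℂ) ^ (v - a) ≠ 0 := by
      rw [Ne, cpow_eq_zero_iff, not_and_or]; exact Or.inl hn'
    have c3 : (n : ℂ) ^ (v - b) ≠ 0 := by
      rw [Ne, cpow_eq_zero_iff, not_and_or]; exact Or.inl hn'
    have hc : (n : ℂ) ^ v * (n : ℂ) ^ (v - a - b) = (n : ℂ) ^ (v - a) * (n : ℂ) ^ (v - b) := by
      rw [← cpow_add _ _ hn', ← cpow_add _ _ hn']
      ring_nf
    -- values of the four shifted Gammas
    have e0 : Gamma (v + (n + 1)) = (n : ℂ) ^ v * n ! * Gamma v / GammaSeq v n := by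
      rw [eq_div_iff g0, k0]
    have e1 : Gamma (v - a - b + (n + 1)) =
        (n : ℂ) ^ (v - a - b) * n ! * Gamma (v - a - b) / GammaSeq (v - a - b) n := by
      rw [eq_div_iff g1, k1]
    have e2 : Gamma (v - a + (n + 1)) = (n : ℂ) ^ (v - a) * n ! * Gamma (v - a) / GammaSeq (v - a) n := by
      rw [eq_div_iff g2, k2]
    have e3 : Gamma (v - b + (n + 1)) = (n : ℂ) ^ (v - b) * n ! * Gamma (v - b) / GammaSeq (v - b) n := by
      rw [eq_div_iff g3, k3]
    have r1 : v + (n + 1) - a - b = v - a - b + (n + 1) := by ring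
    have r2 : v + (n + 1) - a = v - a + (n + 1) := by ring
    have r3 : v + (n + 1) - b = v - b + (n + 1) := by ring
    have hA : ((n : ℂ) ^ v * n ! * Gamma v) * ((n : ℂ) ^ (v - a - b) * n ! * Gamma (v - a - b)) =
        ((n ! : ℂ) ^ 2 * (n : ℂ) ^ (v - a) * (n : ℂ) ^ (v - b)) * (Gamma v * Gamma (v - a - b)) := by
      linear_combination ((n ! : ℂ) ^ 2 * Gamma v * Gamma (v - a - b)) * hc
    have hB : ((n : ℂ) ^ (v - a) * n ! * Gamma (v - a)) * ((n : ℂ) ^ (v - b) * n ! * Gamma (v - b)) =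
        ((n ! : ℂ) ^ 2 * (n : ℂ) ^ (v - a) * (n : ℂ) ^ (v - b)) * (Gamma (v - a) * Gamma (v - b)) := by
      ring
    have hN : (n ! : ℂ) ^ 2 * (n : ℂ) ^ (v - a) * (n : ℂ) ^ (v - b) ≠ 0 :=
      mul_ne_zero (mul_ne_zero (pow_ne_zero 2 hfact) c2) c3
    have hA2 : (n : ℂ) ^ (v - a) * n ! * Gamma (v - a) ≠ 0 := mul_ne_zero (mul_ne_zero c2 hfact) hΓ2
    have hA3 : (n : ℂ) ^ (v - b) * n ! * Gamma (v - b) ≠ 0 := mul_ne_zero (mul_ne_zero c3 hfact) hΓ3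
    unfold gaussRatio
    rw [r1, r2, r3, e0, e1, e2, e3]
    have step : (n : ℂ) ^ v * n ! * Gamma v / GammaSeq v n *
        ((n : ℂ) ^ (v - a - b) * n ! * Gamma (v - a - b) / GammaSeq (v - a - b) n) *
        (((n : ℂ) ^ (v - a) * n ! * Gamma (v - a) / GammaSeq (v - a) n)⁻¹ *
          ((n : ℂ) ^ (v - b) * n ! * Gamma (v - b) / GammaSeq (v - b) n)⁻¹) =
        ((n : ℂ) ^ v * n ! * Gamma v) * ((n : ℂ) ^ (v - a - b) * n ! * Gamma (v - a - b)) /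
          (((n : ℂ) ^ (v - a) * n ! * Gamma (v - a)) * ((n : ℂ) ^ (v - b) * n ! * Gamma (v - b))) *
          (GammaSeq (v - a) n * GammaSeq (v - b) n / (GammaSeq v n * GammaSeq (v - a - b) n)) := by
      field_simp
    rw [step, hA, hB, mul_div_mul_left _ _ hN]
    field_simp
  have hlim' : Tendsto (fun n : ℕ => gaussRatio a b (v + (n + 1))) atTop (𝓝 1) := by
    refine hlim.congr' ?_
    filter_upwards [eventually_ne_atTop 0] with n hn
    rw [hev n hn]
  rw [← tendsto_add_atTop_iff_nat (f := fun N : ℕ => gaussRatio a b (v + N)) 1]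
  refine hlim'.congr' (Eventually.of_forall fun n => ?_)
  push_cast
  ring_nf

/-- `T_K(v + N) → 1` as `N → ∞` (`Re v ≥ 0`). [folklore] -/
theorem tendsto_partialSum_add_nat (a b : ℂ) (K : ℕ) {v : ℂ} (hv : 0 ≤ v.re) :
    Tendsto (fun N : ℕ => partialSum a b K (v + N)) atTop (𝓝 1) := by
  rw [tendsto_iff_norm_sub_tendsto_zero]
  have hb : Tendsto (fun N : ℕ => coeffNormSum a b K / (N : ℝ)) atTop (𝓝 0) :=
    tendsto_const_div_atTop_nhds_zero_nat _
  refine squeeze_zero' (Eventually.of_forall fun N => norm_nonneg _) ?_ hb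
  filter_upwards [eventually_ge_atTop 1] with N hN
  have hN1 : (1 : ℝ) ≤ N := by exact_mod_cast hN
  have hre : 0 ≤ (v + (N : ℂ)).re := by simp; linarith
  have hnorm : (N : ℝ) ≤ ‖v + (N : ℂ)‖ := by
    have := Complex.re_le_norm (v + (N : ℂ))
    simp at this
    linarith
  have h1 : 1 ≤ ‖v + (N : ℂ)‖ := hN1.trans hnorm
  refine (norm_partialSum_sub_one_le a b K hre h1).trans ?_
  exact div_le_div_of_nonneg_left (coeffNormSum_nonneg a b K) (by linarith) hnorm

/-! ### Non-vanishing on the region -/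

/-- On `0 < Re v`, `2‖c‖ + 1 ≤ ‖v‖`: `v - c` is not a pole of `Γ`. [folklore] -/
lemma sub_ne_neg_nat {v c : ℂ} (hv : 0 < v.re) (hR : 2 * ‖c‖ + 1 ≤ ‖v‖) (m : ℕ) :
    v - c ≠ -m := by
  intro h
  have hv' : v = c - m := by linear_combination h
  have hre : v.re = c.re - m := by rw [hv']; simp
  have hm : (m : ℝ) < ‖c‖ := by
    have := Complex.re_le_norm c
    have h' : (m : ℝ) < c.re := by linarith
    linarith [abs_re_le_norm c, le_abs_self c.re]
  have hnorm : ‖v‖ ≤ ‖c‖ + m := by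
    rw [hv']
    calc ‖c - (m : ℂ)‖ ≤ ‖c‖ + ‖(m : ℂ)‖ := norm_sub_le _ _
      _ = ‖c‖ + m := by simp
  linarith

/-! ### The main estimate -/

/-- **Asymptotic Gauss summation** (inverse factorial expansion of a balanced ratio of four Gamma
functions, to every order, uniformly up to the imaginary axis). For all complex `a, b` and every
`K` there are `R > 0` and `C ≥ 0` such that

  `‖Γ(v)Γ(v−a−b)/(Γ(v−a)Γ(v−b)) − Σ_{k ≤ K} ((a)_k (b)_k / k!) / (v(v+1)⋯(v+k−1))‖ ≤ C/‖v‖^{K+1}`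

for all `v` with `0 < Re v` and `R ≤ ‖v‖`. (The series converges to the left side for
`Re v > Re(a+b)` by Gauss's theorem `₂F₁(a,b;v;1) = Γ(v)Γ(v−a−b)/(Γ(v−a)Γ(v−b))`; only the
asymptotic statement is proved here, by Gauss's telescoping argument of §14·11 applied to the
truncated series.) [cite: WhittakerWatson1927, §14·11] -/
theorem norm_gaussRatio_sub_partialSum_le (a b : ℂ) (K : ℕ) :
    ∃ R C : ℝ, 0 < R ∧ 0 ≤ C ∧ ∀ v : ℂ, 0 < v.re → R ≤ ‖v‖ →
      ‖gaussRatio a b v - partialSum a b K v‖ ≤ C / ‖v‖ ^ (K + 1) := by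
  set M : ℝ := ‖((K : ℂ) + a) * (K + b) * coeff a b K‖ with hM
  set S : ℝ := coeffNormSum a b K with hS
  have hM0 : 0 ≤ M := norm_nonneg _
  have hS0 : 0 ≤ S := coeffNormSum_nonneg a b K
  refine ⟨2 * S + 2 * ‖a‖ + 2 * ‖b‖ + 12 * M + 1, 36 * M, by positivity, by positivity, ?_⟩
  intro v hv hR
  have hv1 : 1 ≤ ‖v‖ := by linarith [norm_nonneg a, norm_nonneg b]
  have hv0 : 0 < ‖v‖ := by linarith
  -- properties at the shifted points `w = v + j`
  have hw_re : ∀ j : ℕ, 0 < (v + (j : ℂ)).re := fun j => by simp; positivity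
  have hw_norm : ∀ j : ℕ, ‖v‖ ≤ ‖v + (j : ℂ)‖ := fun j => norm_le_norm_add_nat hv.le j
  have hT_sub : ∀ j : ℕ, ‖partialSum a b K (v + j) - 1‖ ≤ 1 / 2 := by
    intro j
    have h := norm_partialSum_sub_one_le a b K (hw_re j).le (hv1.trans (hw_norm j))
    refine h.trans ?_
    rw [div_le_div_iff₀ (by linarith [hw_norm j]) (by norm_num : (0:ℝ) < 2)]
    nlinarith [hw_norm j, norm_nonneg a, norm_nonneg b]
  have hT_ne : ∀ j : ℕ, partialSum a b K (v + j) ≠ 0 := by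
    intro j h
    have := hT_sub j
    rw [h] at this
    norm_num at this
  have hT_norm : ∀ j : ℕ, 1 / 2 ≤ ‖partialSum a b K (v + j)‖ := by
    intro j
    have := hT_sub j
    have h2 : ‖(1 : ℂ)‖ - ‖partialSum a b K (v + j)‖ ≤ ‖(1 : ℂ) - partialSum a b K (v + j)‖ :=
      norm_sub_norm_le _ _
    rw [norm_sub_rev] at h2
    simp at h2
    linarith
  have hT_norm' : ∀ j : ℕ, ‖partialSum a b K (v + j)‖ ≤ 3 / 2 := by
    intro j
    have := hT_sub j
    have h2 : ‖partialSum a b K (v + j)‖ - ‖(1 : ℂ)‖ ≤ ‖partialSum a b K (v + j) - 1‖ :=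
      norm_sub_norm_le _ _
    simp at h2
    linarith
  -- no poles at the shifted points
  have hab : ‖a + b‖ ≤ ‖a‖ + ‖b‖ := norm_add_le a b
  have hp0 : ∀ j m : ℕ, v + (j : ℂ) ≠ -m := fun j m => add_nat_ne_neg_nat hv j m
  have hp1 : ∀ j m : ℕ, v + (j : ℂ) - a - b ≠ -m := by
    intro j m h
    refine sub_ne_neg_nat (c := a + b) (hw_re j) ?_ m (by rw [← h]; ring)
    linarith [hw_norm j]
  have hp2 : ∀ j m : ℕ, v + (j : ℂ) - a ≠ -m := fun j m =>
    sub_ne_neg_nat (c := a) (hw_re j) (by linarith [hw_norm j, norm_nonneg b]) m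
  have hp3 : ∀ j m : ℕ, v + (j : ℂ) - b ≠ -m := fun j m =>
    sub_ne_neg_nat (c := b) (hw_re j) (by linarith [hw_norm j, norm_nonneg a]) m
  have hz1 : ∀ j : ℕ, v + (j : ℂ) - a - b ≠ 0 := fun j => by simpa using hp1 j 0
  have hz2 : ∀ j : ℕ, v + (j : ℂ) - a ≠ 0 := fun j => by simpa using hp2 j 0
  have hz3 : ∀ j : ℕ, v + (j : ℂ) - b ≠ 0 := fun j => by simpa using hp3 j 0
  have hvi : ∀ j i : ℕ, v + (j : ℂ) + i ≠ 0 := fun j i => add_nat_ne_zero (hw_re j) i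
  have hG_ne : ∀ j : ℕ, gaussRatio a b (v + j) ≠ 0 := by
    intro j
    unfold gaussRatio
    refine mul_ne_zero (mul_ne_zero (Gamma_ne_zero (hp0 j)) (Gamma_ne_zero (hp1 j))) ?_
    exact mul_ne_zero (inv_ne_zero (Gamma_ne_zero (hp2 j))) (inv_ne_zero (Gamma_ne_zero (hp3 j)))
  -- size of `η = ε/T` at the shifted points
  set η : ℂ → ℂ := fun w => eps a b K w / partialSum a b K w with hη
  have hvK : 0 < ‖v‖ ^ K := pow_pos hv0 K
  have hη_le : ∀ j : ℕ, ‖η (v + j)‖ ≤ 4 * M / ‖v‖ ^ K * (1 / ‖v + (j : ℂ)‖ ^ 2) := by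
    intro j
    have hwpos : 0 < ‖v + (j : ℂ)‖ := by linarith [hw_norm j]
    have hε := norm_eps_le a b K (hw_re j).le hwpos (by linarith [hw_norm j])
    have h1 : ‖η (v + j)‖ ≤ 2 * ‖eps a b K (v + j)‖ := by
      simp only [hη, norm_div]
      rw [div_le_iff₀ (by linarith [hT_norm j])]
      nlinarith [hT_norm j, norm_nonneg (eps a b K (v + j))]
    refine h1.trans ?_
    have hpow : ‖v‖ ^ K * ‖v + (j : ℂ)‖ ^ 2 ≤ ‖v + (j : ℂ)‖ ^ (K + 2) := by
      rw [pow_add]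
      exact mul_le_mul_of_nonneg_right (pow_le_pow_left₀ hv0.le (hw_norm j) K) (by positivity)
    calc 2 * ‖eps a b K (v + ↑j)‖ ≤ 2 * (2 * M / ‖v + (j : ℂ)‖ ^ (K + 2)) := by linarith
      _ = 4 * M / ‖v + (j : ℂ)‖ ^ (K + 2) := by ring
      _ ≤ 4 * M / (‖v‖ ^ K * ‖v + (j : ℂ)‖ ^ 2) := by
          apply div_le_div_of_nonneg_left (by positivity) (by positivity) hpow
      _ = 4 * M / ‖v‖ ^ K * (1 / ‖v + (j : ℂ)‖ ^ 2) := by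
          field_simp
  -- the sum of the `η`'s
  set σ : ℝ := 12 * M / ‖v‖ ^ (K + 1) with hσ
  have hσ0 : 0 ≤ σ := by positivity
  have hσ1 : σ ≤ 1 := by
    have h12 : 12 * M ≤ ‖v‖ := by linarith [norm_nonneg a, norm_nonneg b]
    have : ‖v‖ ≤ ‖v‖ ^ (K + 1) := by
      calc ‖v‖ = ‖v‖ ^ 1 := (pow_one _).symm
        _ ≤ ‖v‖ ^ (K + 1) := pow_le_pow_right₀ hv1 (by omega)
    rw [hσ, div_le_one (by positivity)]
    linarith
  have hsum : ∀ N : ℕ, ∑ j ∈ Finset.range N, ‖η (v + j)‖ ≤ σ := by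
    intro N
    have h1 : ∑ j ∈ Finset.range N, ‖η (v + j)‖ ≤
        4 * M / ‖v‖ ^ K * ∑ j ∈ Finset.range N, 1 / ‖v + (j : ℂ)‖ ^ 2 := by
      rw [Finset.mul_sum]
      exact Finset.sum_le_sum fun j _ => hη_le j
    have h2 := GammaStirling.sum_inv_norm_add_sq_le hv N
    have h3 : 1 / ‖v‖ ^ 2 + Real.pi / (2 * ‖v‖) ≤ 3 / ‖v‖ := by
      have hpi := Real.pi_lt_four
      have e1 : 1 / ‖v‖ ^ 2 ≤ 1 / ‖v‖ :=
        div_le_div_of_nonneg_left zero_le_one hv0 (by nlinarith)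
      have e2 : Real.pi / (2 * ‖v‖) ≤ 2 / ‖v‖ := by
        rw [div_le_div_iff₀ (by positivity) hv0]
        nlinarith [mul_lt_mul_of_pos_right hpi hv0]
      rw [show (3 : ℝ) / ‖v‖ = 1 / ‖v‖ + 2 / ‖v‖ by ring]
      exact add_le_add e1 e2
    calc ∑ j ∈ Finset.range N, ‖η (v + j)‖
        ≤ 4 * M / ‖v‖ ^ K * (3 / ‖v‖) := h1.trans (by gcongr; exact h2.trans h3)
      _ = σ := by rw [hσ]; field_simp; ring
  -- telescoping: `Q(v) = Q(v+N) ∏_{j<N} (1 + η(v+j))`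
  set Q : ℂ → ℂ := fun w => gaussRatio a b w / partialSum a b K w with hQdef
  have htel : ∀ N : ℕ, Q v = Q (v + N) * ∏ j ∈ Finset.range N, (1 + η (v + j)) := by
    intro N
    induction N with
    | zero => simp
    | succ N ih =>
      have hT1 : partialSum a b K (v + N + 1) ≠ 0 := by
        have := hT_ne (N + 1)
        push_cast at this
        rwa [← add_assoc] at this
      have step := quot_eq_quot_add_one_mul a b (v := v + N) (hvi N) (hz1 N) (hz2 N) (hz3 N) K
        (hT_ne N) hT1
      rw [Finset.prod_range_succ, ih]
      simp only [hQdef, hη] at step ⊢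
      rw [step]
      push_cast
      ring_nf
  -- the limit `Q(v+N) → 1`
  have hv_poles : ∀ m : ℕ, v ≠ -m := fun m => by simpa using hp0 0 m
  have h1v : ∀ m : ℕ, v - a - b ≠ -m := fun m => by simpa using hp1 0 m
  have h2v : ∀ m : ℕ, v - a ≠ -m := fun m => by simpa using hp2 0 m
  have h3v : ∀ m : ℕ, v - b ≠ -m := fun m => by simpa using hp3 0 m
  have hQlim : Tendsto (fun N : ℕ => Q (v + N)) atTop (𝓝 1) := by
    have h : Tendsto (fun N : ℕ => gaussRatio a b (v + N) / partialSum a b K (v + N)) atTop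
        (𝓝 (1 / 1)) :=
      (tendsto_gaussRatio_add_nat a b hv_poles h1v h2v h3v).div
        (tendsto_partialSum_add_nat a b K hv.le) one_ne_zero
    simpa [hQdef] using h
  have hQ_ne : ∀ N : ℕ, Q (v + N) ≠ 0 := fun N => div_ne_zero (hG_ne N) (hT_ne N)
  have hPlim : Tendsto (fun N : ℕ => ∏ j ∈ Finset.range N, (1 + η (v + j))) atTop (𝓝 (Q v)) := by
    have h : Tendsto (fun N : ℕ => Q v / Q (v + N)) atTop (𝓝 (Q v / 1)) :=
      (tendsto_const_nhds (x := Q v)).div hQlim one_ne_zero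
    rw [div_one] at h
    refine h.congr' (Eventually.of_forall fun N => ?_)
    rw [div_eq_iff (hQ_ne N), mul_comm]
    exact htel N
  -- the product stays within `2σ` of `1`, hence so does `Q(v)`
  have hPbound : ∀ N : ℕ, ‖∏ j ∈ Finset.range N, (1 + η (v + j)) - 1‖ ≤ 2 * σ := by
    intro N
    refine (norm_prod_one_add_sub_one_le (fun j => η (v + j)) N).trans ?_
    have hexp : Real.exp (∑ j ∈ Finset.range N, ‖η (v + j)‖) ≤ Real.exp σ :=
      Real.exp_le_exp.mpr (hsum N)
    have hσabs : |σ| ≤ 1 := by rw [abs_of_nonneg hσ0]; exact hσ1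
    have h2 := Real.abs_exp_sub_one_sub_id_le hσabs
    have h3 : Real.exp σ - 1 - σ ≤ σ ^ 2 := (le_abs_self _).trans h2
    nlinarith
  have hQbound : ‖Q v - 1‖ ≤ 2 * σ :=
    le_of_tendsto' ((hPlim.sub_const 1).norm) hPbound
  -- conclusion
  have hTv : partialSum a b K v ≠ 0 := by simpa using hT_ne 0
  have hTv' : ‖partialSum a b K v‖ ≤ 3 / 2 := by simpa using hT_norm' 0
  have hGT : gaussRatio a b v - partialSum a b K v = partialSum a b K v * (Q v - 1) := by
    simp only [hQdef]
    field_simp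
  rw [hGT, norm_mul]
  calc ‖partialSum a b K v‖ * ‖Q v - 1‖ ≤ (3 / 2) * (2 * σ) :=
        mul_le_mul hTv' hQbound (norm_nonneg _) (by norm_num)
    _ = 36 * M / ‖v‖ ^ (K + 1) := by rw [hσ]; ring

/-! ### Regularity, and the duplication identity behind Booker's (13) -/

/-- `G` is holomorphic away from the poles of `Γ(v)` and `Γ(v−a−b)` (Mathlib's `1/Γ` is entire).
[folklore] -/
theorem differentiableAt_gaussRatio (a b : ℂ) {v : ℂ} (h0 : ∀ m : ℕ, v ≠ -m)
    (h1 : ∀ m : ℕ, v - a - b ≠ -m) : DifferentiableAt ℂ (gaussRatio a b) v := by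
  have e : gaussRatio a b = fun v => Gamma v * Gamma (v - a - b) *
      ((Gamma (v - a))⁻¹ * (Gamma (v - b))⁻¹) := rfl
  rw [e]
  refine ((differentiableAt_Gamma v h0).mul ?_).mul (DifferentiableAt.mul ?_ ?_)
  · exact (differentiableAt_Gamma _ h1).comp v ((differentiableAt_id.sub_const a).sub_const b)
  · exact differentiable_one_div_Gamma.differentiableAt.comp v (differentiableAt_id.sub_const a)
  · exact differentiable_one_div_Gamma.differentiableAt.comp v (differentiableAt_id.sub_const b)

/-- `G` is holomorphic on the right half-plane `Re v > max(0, Re(a+b))`. [folklore] -/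
theorem differentiableOn_gaussRatio (a b : ℂ) :
    DifferentiableOn ℂ (gaussRatio a b) {v : ℂ | 0 < v.re ∧ (a + b).re < v.re} := by
  intro v hv
  have h0 : ∀ m : ℕ, v ≠ -m := fun m => by simpa using add_nat_ne_neg_nat hv.1 0 m
  refine (differentiableAt_gaussRatio a b h0 fun m => ?_).differentiableWithinAt
  have h : 0 < (v - a - b).re := by simp at hv ⊢; linarith [hv.2]
  simpa using add_nat_ne_neg_nat h 0 m

/-- `√(8π) = 2^{3/2} √π` in `ℂ`. [folklore] -/
lemma sqrt_eight_pi : ((Real.sqrt (8 * Real.pi) : ℝ) : ℂ) = (2 : ℂ) ^ ((3 : ℂ) / 2) * (Real.sqrt Real.pi : ℂ) := by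
  rw [Real.sqrt_mul (by norm_num) Real.pi, Complex.ofReal_mul]
  congr 1
  have h8 : (8 : ℝ) = (2 : ℝ) ^ ((3 : ℝ)) := by
    rw [show (3 : ℝ) = ((3 : ℕ) : ℝ) by norm_num, Real.rpow_natCast]; norm_num
  rw [h8, Real.sqrt_eq_rpow, ← Real.rpow_mul (by norm_num), Complex.ofReal_cpow (by norm_num)]
  push_cast
  ring_nf

/-- The duplication identity behind [Booker2003, (13)]: for `Re z > 1/2`,
`2^z Γ(z/2)² = √(8π) Γ(z − 1/2) · G(z/2)` with `G = gaussRatio (1/4) (−1/4)`, i.e.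
`Γ(z/2)²/(2^{−z} Γ(z − 1/2)) = √(8π) Γ(v)²/(Γ(v − 1/4)Γ(v + 1/4))`, `v = z/2`.
[cite: Booker2003, (13) p. 1094; folklore] -/
theorem two_cpow_mul_Gamma_half_sq {z : ℂ} (hz : 1 / 2 < z.re) :
    (2 : ℂ) ^ z * Gamma (z / 2) ^ 2 =
      (Real.sqrt (8 * Real.pi) : ℂ) * Gamma (z - 1 / 2) * gaussRatio (1 / 4) (-1 / 4) (z / 2) := by
  have hΓ : Gamma (z - 1 / 2) ≠ 0 := Gamma_ne_zero_of_re_pos (by simp; linarith)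
  have hsπ : (Real.sqrt Real.pi : ℂ) ≠ 0 := by
    exact_mod_cast (Real.sqrt_pos.mpr Real.pi_pos).ne'
  have h2 : ∀ w : ℂ, (2 : ℂ) ^ w ≠ 0 := fun w => by
    rw [Ne, cpow_eq_zero_iff, not_and_or]; exact Or.inl two_ne_zero
  have hdup : Gamma (z / 2 - 1 / 4) * Gamma (z / 2 + 1 / 4) =
      Gamma (z - 1 / 2) * (2 : ℂ) ^ ((3 : ℂ) / 2 - z) * (Real.sqrt Real.pi : ℂ) := by
    have h := Complex.Gamma_mul_Gamma_add_half (z / 2 - 1 / 4)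
    have e1 : z / 2 - 1 / 4 + 1 / 2 = z / 2 + 1 / 4 := by ring
    have e2 : 2 * (z / 2 - 1 / 4) = z - 1 / 2 := by ring
    have e3 : 1 - (z - 1 / 2) = (3 : ℂ) / 2 - z := by ring
    rwa [e1, e2, e3] at h
  have hG : gaussRatio (1 / 4) (-1 / 4) (z / 2) =
      Gamma (z / 2) * Gamma (z / 2) * (Gamma (z / 2 - 1 / 4) * Gamma (z / 2 + 1 / 4))⁻¹ := by
    simp only [gaussRatio, ← mul_inv]
    congr 2 <;> ring_nf
  have hpow : (2 : ℂ) ^ z * (2 : ℂ) ^ ((3 : ℂ) / 2 - z) = (2 : ℂ) ^ ((3 : ℂ) / 2) := by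
    rw [← cpow_add _ _ two_ne_zero]; ring_nf
  have hp : (2 : ℂ) ^ ((3 : ℂ) / 2 - z) ≠ 0 := h2 _
  have e2z : (2 : ℂ) ^ z = (2 : ℂ) ^ ((3 : ℂ) / 2) * ((2 : ℂ) ^ ((3 : ℂ) / 2 - z))⁻¹ := by
    rw [← hpow, mul_assoc, mul_inv_cancel₀ hp, mul_one]
  have hg : Gamma (z - 1 / 2) * (Gamma (z - 1 / 2))⁻¹ = 1 := mul_inv_cancel₀ hΓ
  have hr : (Real.sqrt Real.pi : ℂ) * (Real.sqrt Real.pi : ℂ)⁻¹ = 1 := mul_inv_cancel₀ hsπ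
  rw [hG, hdup, sqrt_eight_pi, mul_inv, mul_inv, e2z]
  linear_combination (-((2 : ℂ) ^ ((3 : ℂ) / 2) * ((2 : ℂ) ^ ((3 : ℂ) / 2 - z))⁻¹ * Gamma (z / 2) ^ 2)) * hg
    + (-((2 : ℂ) ^ ((3 : ℂ) / 2) * ((2 : ℂ) ^ ((3 : ℂ) / 2 - z))⁻¹ * Gamma (z / 2) ^ 2 *
        (Gamma (z - 1 / 2) * (Gamma (z - 1 / 2))⁻¹))) * hr

end GaussRatio

end Literature.Analysis.SpecialFunctions
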